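import Literature.Computability.QuantumComplexity.HybridArgument
import Literature.Computability.QuantumComplexity.OraclePolynomialMethod
import HarnessLib

/-!
# Query magnitudes are polynomials of degree `≤ 2T` in the oracle bits (Beals et al. 2001, Lemma 4.1, applied to BBBV's query magnitude)

Beals–Buhrman–Cleve–Mosca–de Wolf, Lemma 4.1: after `t` oracle queries every amplitude of the state is a polynomial
of degree `≤ t` in the oracle bits; Lemma 4.2: a probability read off the final state is a real polynomial of degree
`≤ 2T`. The tree has both for ACCEPTANCE probabilities (`OraclePolynomialMethod.lean`:
`ohasDegreeLE_toMatrix_mulVec`, `exists_acceptPolynomial_circuit`). This file records the same consequence of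
Lemma 4.1 for the BBBV QUERY MAGNITUDES of `HybridArgument.lean` (`queryWeight`, `queryWeights`: the squared
amplitude on the basis states whose query register spells a string of `D`, at each oracle gate), the quantity the
Bennett–Bernstein–Brassard–Vazirani hybrid argument and the Aaronson–Ambainis greedy (influence ≈ query magnitude)
test:

* `OHasDegreeLE.exists_normSq_poly` — `|a(A)|²` of a degree-`≤ d` amplitude is a real polynomial of degree `≤ 2d`;
* `exists_queryWeight_poly` — so is the query magnitude of a state of degree `≤ d`;
* **`exists_sum_queryWeights_poly`** — along a gate list run from a state family of degree `≤ d`, the TOTAL query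
  magnitude `Σ_t q_D(|φ_t⟩)` is a real polynomial of degree `≤ 2(d + #oracle gates)` in the oracle bits;
* **`exists_sumQueryWeightsPolynomialOn`** — for a circuit family `F` on input `x` (state `|x, 0…0⟩`), the total
  query magnitude of `D` is a real polynomial of degree `≤ 2T` in the oracle bits of the strings of length
  `< |x| + ancillas`, `T = #oracle gates`.

Sources: R. Beals, H. Buhrman, R. Cleve, M. Mosca, R. de Wolf, J. ACM 48 (2001), Lemma 4.1 / 4.2
[cite: BealsEtAl2001, Lemma 4.1]; C. H. Bennett, E. Bernstein, G. Brassard, U. Vazirani, SIAM J. Comput. 26 (1997),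
Def. 3.2 (query magnitude) [cite: BennettBernsteinBrassardVazirani1997, Def. 3.2].
-/

noncomputable section

namespace Literature.Computability.QuantumComplexity

open Matrix Finset Literature.Computability.Cryptography

variable {G : QGateSet} {N : ℕ}

/-- **The squared modulus of a degree-`≤ d` amplitude is a real polynomial of degree `≤ 2d`** (`|a|² = P² + Q²`).
[cite: BealsEtAl2001, Lemma 4.2 (proof)] -/
theorem OHasDegreeLE.exists_normSq_poly {d : ℕ} {a : Language Bool → ℂ} (ha : OHasDegreeLE N d a) :
    ∃ P : MvPolynomial (OracleVar N) ℝ, P.totalDegree ≤ 2 * d ∧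
      ∀ A, ‖a A‖ ^ 2 = MvPolynomial.eval (oraclePt N A) P := by
  obtain ⟨P, Q, hP, hQ, h⟩ := ha
  refine ⟨P ^ 2 + Q ^ 2, ?_, fun A => ?_⟩
  · refine (MvPolynomial.totalDegree_add _ _).trans (max_le ?_ ?_)
    · exact (MvPolynomial.totalDegree_pow _ _).trans (by nlinarith)
    · exact (MvPolynomial.totalDegree_pow _ _).trans (by nlinarith)
  · rw [h A, Complex.sq_norm, Complex.normSq_apply]
    simp
    ring

/-- **The query magnitude of a degree-`≤ d` state is a real polynomial of degree `≤ 2d`.**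
[cite: BealsEtAl2001, Lemma 4.2 (proof)] [cite: BennettBernsteinBrassardVazirani1997, Def. 3.2] -/
theorem exists_queryWeight_poly {k d : ℕ} (D : Set (List Bool)) (e : Fin (k + 1) ↪ Fin N)
    {ψ : Language Bool → QReg N → ℂ} (hψ : ∀ s, OHasDegreeLE N d fun A => ψ A s) :
    ∃ P : MvPolynomial (OracleVar N) ℝ, P.totalDegree ≤ 2 * d ∧
      ∀ A, queryWeight D e (ψ A) = MvPolynomial.eval (oraclePt N A) P := by
  classical
  choose P hP h using fun s => (hψ s).exists_normSq_poly
  refine ⟨∑ s : QReg N, if queryOf e s ∈ D then P s else 0, ?_, fun A => ?_⟩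
  · refine (MvPolynomial.totalDegree_finsetSum _ _).trans (Finset.sup_le fun s _ => ?_)
    split_ifs
    · exact hP s
    · simp
  · rw [queryWeight, map_sum]
    refine Finset.sum_congr rfl fun s _ => ?_
    split_ifs
    · exact h s A
    · simp

/-- **The total query magnitude along a gate list is a real polynomial of degree `≤ 2(d + #oracle gates)`** when
the run starts from a state family of degree `≤ d` (induction on the gates: an oracle-free gate keeps the degree,
an oracle gate contributes its magnitude — degree `≤ 2d` — and raises the state degree by one).
[cite: BealsEtAl2001, Lemma 4.1] [cite: BennettBernsteinBrassardVazirani1997, Def. 3.2] -/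
theorem exists_sum_queryWeights_poly (D : Set (List Bool)) :
    ∀ (gs : List (QGate G N)) {d : ℕ} {ψ : Language Bool → QReg N → ℂ},
      (∀ s, OHasDegreeLE N d fun A => ψ A s) →
      ∃ P : MvPolynomial (OracleVar N) ℝ, P.totalDegree ≤ 2 * (d + (⟨gs⟩ : QCircuit G N).oracleQueries) ∧
        ∀ A, (queryWeights A D gs (ψ A)).sum = MvPolynomial.eval (oraclePt N A) P
  | [], d, ψ, _ => ⟨0, by simp, fun A => by simp [queryWeights]⟩
  | QGate.gate g e :: gs, d, ψ, hψ => by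
    have hq : (⟨QGate.gate g e :: gs⟩ : QCircuit G N).oracleQueries = (⟨gs⟩ : QCircuit G N).oracleQueries := by
      simp [QCircuit.oracleQueries, QGate.IsOracleFree]
    obtain ⟨P, hP, h⟩ := exists_sum_queryWeights_poly D gs (d := d)
      (ψ := fun A => (QGate.gate g e : QGate G N).toMatrix A *ᵥ ψ A)
      (fun s => by simpa using OHasDegreeLE.mulVec (placeGate e (G.mat g)) hψ s)
    refine ⟨P, by rw [hq]; exact hP, fun A => ?_⟩
    rw [queryWeights, QGate.queryWeights, List.nil_append]
    exact h A
  | QGate.oracle k e :: gs, d, ψ, hψ => by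
    have hq : (⟨QGate.oracle k e :: gs⟩ : QCircuit G N).oracleQueries =
        (⟨gs⟩ : QCircuit G N).oracleQueries + 1 := by
      simp [QCircuit.oracleQueries, QGate.IsOracleFree]
    obtain ⟨P₀, hP₀, h₀⟩ := exists_queryWeight_poly D e hψ
    obtain ⟨P, hP, h⟩ := exists_sum_queryWeights_poly D gs (d := d + 1)
      (ψ := fun A => (QGate.oracle k e : QGate G N).toMatrix A *ᵥ ψ A)
      (fun s => by simpa using OHasDegreeLE.oracleGate e hψ s)
    refine ⟨P₀ + P, ?_, fun A => ?_⟩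
    · rw [hq]
      refine (MvPolynomial.totalDegree_add _ _).trans (max_le ?_ ?_)
      · omega
      · exact hP.trans (by omega)
    · rw [queryWeights, QGate.queryWeights, List.singleton_append, List.sum_cons, map_add, h₀ A]
      exact congrArg _ (h A)

/-- **The total query magnitude of a circuit on `|x, 0^m⟩` is a real polynomial of degree `≤ 2T`** in the oracle
bits of the strings of length `< n + m`. [cite: BealsEtAl2001, Lemma 4.1] [cite: BennettBernsteinBrassardVazirani1997, Def. 3.2] -/
theorem exists_sum_queryWeights_circuit_poly {n m : ℕ} (C : QCircuit G (n + m)) (x : QReg n) (D : Set (List Bool)) :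
    ∃ P : MvPolynomial (OracleVar (n + m)) ℝ, P.totalDegree ≤ 2 * C.oracleQueries ∧
      ∀ A, (queryWeights A D C.gates (basisState (padInput x m))).sum = MvPolynomial.eval (oraclePt (n + m) A) P := by
  obtain ⟨P, hP, h⟩ := exists_sum_queryWeights_poly (G := G) D C.gates (d := 0)
    (ψ := fun _ => basisState (padInput x m)) (fun s => OHasDegreeLE.const 0 _)
  exact ⟨P, by simpa using hP, h⟩

/-- **Family form**: for a circuit family `F` on input `x`, the total query magnitude of `D` in the run on
`|x, 0…0⟩` is a real polynomial of degree `≤ 2 · (F.circ |x|).oracleQueries` in the oracle bits of the strings of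
length `< |x| + ancillas |x|`. [cite: BealsEtAl2001, Lemma 4.1] [cite: BennettBernsteinBrassardVazirani1997, Def. 3.2] -/
theorem exists_sumQueryWeightsPolynomialOn (F : QCircuitFamily G) (x : List Bool) (D : Set (List Bool)) :
    ∃ P : MvPolynomial (OracleVar (x.length + F.ancillas x.length)) ℝ,
      P.totalDegree ≤ 2 * (F.circ x.length).oracleQueries ∧
      ∀ A, (queryWeights A D (F.circ x.length).gates (basisState (padInput x.get (F.ancillas x.length)))).sum =
        MvPolynomial.eval (oraclePt (x.length + F.ancillas x.length) A) P :=
  exists_sum_queryWeights_circuit_poly (F.circ x.length) x.get D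

end Literature.Computability.QuantumComplexity

end
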